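import Literature.NumberTheory.EllipticCurves.BSDSelmerPConverseYanZhuProofs
import Literature.NumberTheory.EllipticCurves.BSDSelmerCMPConverse
import Literature.NumberTheory.EllipticCurves.CMTorsionIrreducibleOrdinaryProofs
import Literature.NumberTheory.EllipticCurves.HeegnerPointsKolyvaginTorsionProofs
import Literature.NumberTheory.EllipticCurves.BSDSelmerPConverseHeegnerSpecializationProofs
import HarnessLib

/-!
# Burungale–Tian's rank-one CM `p`-converse over an AUXILIARY Heegner field (route B)

Sibling proof file (theorems only, no named fact; D-0014/D-0026) of
`Literature.NumberTheory.EllipticCurves.BSDSelmerCMPConverse`, in the story of the named fact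
`Literature.NumberTheory.EllipticCurves.burungaleTian_analyticRank_eq_one_of_selmerCorank_eq_one_of_hasCM`
(A. Burungale, Y. Tian, *`p`-converse to a theorem of Gross–Zagier, Kolyvagin and Rubin*, Invent.
Math. 220 (2020), **Thm. 1.2**, p. 214: for a CM elliptic curve `E/ℚ` and a good ordinary prime
`p > 3`, `corank_{ℤ_p} Sel_{p^∞}(E/ℚ) = 1 ⟹ ord_{s=1} L(s, E/ℚ) = 1`).

## Two routes

Burungale–Tian's printed proof (§4.2.3, pp. 249–250; transcribed in the fact's docstring) runs
over the CM FIELD `M` of `E`: a self-dual pair `(g, χ)`, the Heegner main conjecture for the CM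
abelian variety `B = A_g ⊗ χ` over `M` (Rubin's and Agboola–Howard's `GL₁` main conjectures,
Disegni's `Λ`-adic Gross–Zagier formula) and Yuan–Zhang–Zhang's Gross–Zagier formula on Shimura
curves ("route A"; its `Λ`-module skeleton is the sibling
`BSDSelmerCMPConverseHeegnerDescentProofs`, its arithmetic inputs are absent from the tree).

This file records **route B**, over an AUXILIARY imaginary quadratic field `K ≠ M` satisfying the
classical Heegner hypothesis for `N_E` — the architecture by which the tree ALREADY decomposes the
big-image `p`-converse theorems (Burungale–Skinner–Tian–Wan Thm. 1.10, Yan–Zhu Cor. 1.4: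
`BSDSelmerPConverse`, `BSDSelmerPConverseYanZhuProofs`), namely Yan–Zhu's proof of Thm. 4.15
(arXiv:2412.20078, §4.6): "we can choose an imaginary quadratic field `K` such that
`ord_{s=1} L(E^K, s) ≤ 1` and `(E, K)` satisfies the Heegner hypothesis by [FH]. […]
`corank_{ℤ_p} Sel_{p^∞}(E/K) = 1` implies `ord_{s=1} L(E/K, s) = 1`". Its `K`-level input is
taken, exactly as in `yanZhu_analyticRank_eq_one_of_selmerCorank_eq_one_of_bcgs`, to be
**Burungale–Castella–Grossi–Skinner, *Non-vanishing of Kolyvagin systems and Iwasawa theory*,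
Camb. J. Math. 14 (2026) = arXiv:2312.09301, Thm. 1 with Cor. 1, rank-one case** (§0.1, pp. 3–4 of
the held text `paper:arxiv-2312.09301`): "**Theorem 1** (Kolyvagin's conjecture). Let `E/ℚ` be an
elliptic curve, and let `p` be an odd prime of good ordinary reduction for `E`. Let `K` be a
quadratic imaginary field satisfying (Heeg) [every prime `ℓ ∣ N` splits in `K`], (disc) [`D_K` is
odd and `D_K ≠ -3`], (tor) [`E(K)[p] = 0`], and such that `p` splits in `K`. Assume that the
rational anticyclotomic Main Conjecture holds. Then there exists `n ∈ 𝒩_Heeg` such that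
`κ_n^Heeg ≠ 0`. In particular, `{κ_n^Heeg} ≠ 0` in both of the following cases: ∘ […] ∘ `p > 3`
satisfies (irr) [`E[p]` is an irreducible `G_ℚ`-module]. […] **Corollary 1.** For `E`, `p` and `K`
as in Theorem 1, we have `ord(κ^Heeg) = max{r(E/K)⁺, r(E/K)⁻} - 1`. […] In the rank one case it
yields a `p`-converse to the Gross–Zagier and Kolyvagin theorem:
`corank_{ℤ_p} Sel_{p^∞}(E/K) = 1 ⟹ ord_{s=1} L(E/K, s) = 1`" — the "In particular" for (irr)
resting on Burungale–Castella–Skinner, IMRN 2025 = arXiv:2405.00270, Thm. 1.2.2 (a) (the rational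
Heegner point main conjecture for every `E/ℚ` at a good ordinary `p > 3` with (irr_ℚ), over every
`K` with (disc), (Heeg), (spl)), whose remark reads "Theorem 1.2.2(a) yields a `p`-converse to the
Gross–Zagier and Kolyvagin theorem […] (cf. [Ski20, Wan21, Cas17, BT20, BST21])".

**The point of route B for CM curves.** Theorem 1 and Corollary 1 are printed for EVERY elliptic
curve `E/ℚ` (no non-CM hypothesis — in contrast with Thm. 3 of the same paper, on Kato's Kolyvagin
system, printed for "an elliptic curve without CM"), and a CM curve at a good ordinary prime
`p ≥ 5` satisfies their two image hypotheses:
* (irr): `E[p]` is an irreducible `G_ℚ`-module — the tree THEOREM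
  `WeierstrassCurve.hasIrreducibleModPGaloisRep_of_hasCM_of_five_le` (Serre 1972, §4.5);
* (tor): `E(K)[p] = 0` for the auxiliary (indeed for every) quadratic field `K` — PROVED here from
  (irr) alone (`torsionBy_eq_bot_of_hasIrreducibleModPGaloisRep`; the tree had it only under the
  surjectivity of `ρ̄_{E,p}`, `torsionBy_eq_bot_of_hasSurjectiveModNGaloisRep`, Gross 1991, §2).
Hence Burungale–Tian's Thm. 1.2 follows from BCGS Cor. 1 (rank-one case) AS PRINTED together with
the classical leaves (a) `p`-parity (tree fact `p_parity`), (b) the auxiliary field from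
Hoffstein–Luo 1997 with `d_K ≡ 1 (mod 8)` (tree fact `HoffsteinLuo1997_exists_twist_L_one_ne_zero`
through `exists_heegnerField_split_twist_ne_zero_discr_emod_eight_of_hoffsteinLuo`) and the
Modularity Theorem (tree fact `ModularForms.exists_isNewformOf`), (c) Kato's finiteness theorem
for the twist (tree fact `kato_finite_of_L_one_ne_zero`), (d) the quadratic base-change count of
Selmer coranks (tree THEOREM `selmerCorank_baseChange_quadratic_holds`) and (f) Artin formalism
(tree theorem `analyticRankEK_eq_add_of`): `burungaleTian_analyticRank_eq_one_of_selmerCorank_eq_one_of_hasCM_of_bcgs`.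
Along route B the fact is therefore no longer an apex leaf of the tree: its single deep input is
the `K`-level leaf that the bsd.S25 cluster already carries inline (`hBCGS`, the SAME Lean
rendering as in `BSDSelmerPConverseYanZhuProofs`), shared with Yan–Zhu Cor. 1.4 and BSTW Thm. 1.10.

**Scope note (recorded, not adjudicated).** The CM case lies inside the printed hypotheses of
BCGS Thm. 1 / Cor. 1 and of BCS Thm. 1.2.2 (a). Their proofs route through the Kolyvagin-system
bound with error terms of Castella–Grossi–Lee–Skinner, Invent. Math. 227 (2022), §3.3, whose
Lemma 3.3.3 ("By Serre's open image theorem, `U = ℤ_p^× ∩ im(ρ_E)` is an open subgroup") is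
phrased for non-CM curves (for a CM curve the same conclusion holds by the theory of complex
multiplication: the image of `G_M` in the Cartan subgroup is open), and through Wan's
three-variable divisibility and the two-variable zeta element of BSTW. Burungale–Tian's own proof
(route A) is CM-specific and independent of these. Nothing is asserted here: the `K`-level input
is the explicit hypothesis `hBCGS`.

## Contents

* Part 1 — **no `p`-torsion over a quadratic field under (irr)**: the abstract lemma
  `exists_stable_addSubgroup_of_sq_smul_eq` (a group acting on an abelian group through
  involutions only — `g² = 1` for all `g` — with a non-zero element generating a proper subgroup
  admits a proper non-zero stable subgroup: either every `g` acts as `±1`, and the cyclic subgroup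
  is stable, or some `g` is a genuine involution, the action is commutative, and its
  `-1`-eigengroup is stable, non-zero and proper), and
  `torsionBy_eq_bot_of_hasIrreducibleModPGaloisRep` (`[K : ℚ] = 2`, `p` prime, `E[p]` irreducible
  ⟹ `E(K)[p] = 0`: a `K`-rational `p`-torsion point pulls back to `0 ≠ Q ∈ E[p]` fixed by
  `res(Γ_K)`, hence by all squares of `Γ_ℚ` (`exists_resGal_eq_mul_self`); the subgroup of `E[p]`
  fixed by all squares is `Γ_ℚ`-stable and non-zero, hence all of `E[p]` by (irr), so `Γ_ℚ` acts on
  `E[p] ≅ (ℤ/p)²` through involutions and the abstract lemma contradicts (irr)). No parity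
  condition on `p` is needed.
* Part 2 — **(tor) for CM curves**: `torsionBy_baseChange_eq_bot_of_hasCM_of_five_le`.
* Part 3 — **route B assembled**:
  `analyticRank_eq_one_of_hasCM_of_bcgs_of_rootNumber_eq_neg_one` (from the sign onwards, all
  binders explicit), `burungaleTian_analyticRank_eq_one_of_selmerCorank_eq_one_of_hasCM_of_bcgs`
  (the named fact from `p_parity`, Modularity, Hoffstein–Luo, Kato and `hBCGS`),
  `…_of_bcgs_of_rank_eq_analyticRank` (Kato's finiteness replaced by Gross–Zagier–Kolyvagin over
  `ℚ`, tree reduction `kato_finite_of_L_one_ne_zero_of_rank_eq_analyticRank`) and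
  `…_of_bcgs_of_exists_isNewformOf` (over the common leaf set of the bsd.S19/S20/S25 cluster: the
  sign from Dokchitser–Dokchitser's base-change parity, `rootNumber_eq_neg_one_of_selmerCorank_eq_one_of_facts`).
* Part 4 — **the `K`-level leaf one level down, OFF Howard's locus**: the descent "rational Heegner
  point main conjecture ⟹ `y_K` non-torsion ⟹ `ord_{s=1} L(E/K, s) = 1`" of
  `BSDSelmerPConverseHeegnerIndexZeroProofs` / `BSDSelmerPConverseHeegnerSpecializationProofs`
  (there run on Howard's locus: `ρ_{E,p^∞}|_{Γ_K}` onto `GL₂(ℤ_p)`, which no CM curve satisfies)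
  re-run with the MODULE-THEORETIC conclusions of Howard's Thm. B / Thm. 3.3.7 as hypotheses
  (`𝔖_p(K_∞)` finitely generated, torsion-free, of rank one; `𝒳` of rank one; `ℋ_∞` free of rank
  one) — the shape in which Burungale–Castella–Skinner, IMRN 2025, Thm. 1.2.2 (a) (the rational
  Heegner point main conjecture under (irr_ℚ), for EVERY `E/ℚ`) prints them:
  `heegnerModuleIndex_eq_zero_of_rational_mainConjecture_of_finrank`,
  `pow_smul_heegnerGenerator_notMem_TSubmodule_of_finrank`,
  `exists_mem_generators_zero_not_isOfFinAddOrder_of_finrank`,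
  `exists_point_eq_y_not_isOfFinAddOrder_of_finrank`,
  `analyticRankEK_eq_one_of_heegner_specialization_of_finrank` — the receiving end, for a CM
  curve over its auxiliary field, of BCS Thm. 1.2.2 (a) + control + Perrin-Riou's base-layer
  control and distribution relation + the CM bridge + Gross–Zagier–Kolyvagin, whose output is
  exactly the conclusion `analyticRankEK W K = 1` of the slot `hBCGS` of Part 3.

## References

* [BurungaleTian2019] A. Burungale, Y. Tian, Invent. Math. 220 (2020), Thm. 1.2 (p. 214) and
  §4.2.3 (pp. 249–250) (NSF-PAR 10184490, text key `paper:url-85381420cd53`).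
* [BurungaleEtAl2026] A. Burungale, F. Castella, G. Grossi, C. Skinner, *Non-vanishing of
  Kolyvagin systems and Iwasawa theory*, Camb. J. Math. 14 (2026) = arXiv:2312.09301: §0.1, Thm. 1
  and Cor. 1 with the displayed rank-one `p`-converse (pp. 3–4 of the held text); Thm. 3 (p. 4:
  "without CM").
* [BurungaleCastellaSkinner2025] A. Burungale, F. Castella, C. Skinner, IMRN 2025 =
  arXiv:2405.00270v2: Thm. 1.2.2 (a) and the remark following it (p. 3), Lemma 5.2.3 (p. 10).
* [YanZhu2024MainConjNonCM] X. Yan, X. Zhu, arXiv:2412.20078 = J. Algebra (2026): Thm. 4.15 and its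
  proof (§4.6).
* [GrossLMS1991] B. H. Gross, *Kolyvagin's work on modular elliptic curves* (1991), §2 (sentence
  after (2.2): "`E(K)` contains no `p`-torsion").
* [Serre1972] J.-P. Serre, Invent. Math. 15 (1972), §4.5 (the image for CM curves).
* [HoffsteinLuo1997] J. Hoffstein, W. Luo, Math. Res. Lett. 4 (1997), Theorem (§1).
* [Kato2004Asterisque] K. Kato, Astérisque 295 (2004), Cor. 14.3.
* [DokchitserDokchitserAnnals2010] T. and V. Dokchitser, Ann. of Math. 172 (2010), Thm. 1.4.
-/

noncomputable section

open scoped Classical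

universe u

open WeierstrassCurve

namespace Literature.NumberTheory.EllipticCurves

open Field (absoluteGaloisGroup)
open Field.absoluteGaloisGroup (toAlgEquiv)

/-! ## Part 1. No `p`-torsion over a quadratic field when `E[p]` is irreducible -/

section Abstract

/-- **A group acting through involutions has a proper non-zero stable subgroup.** Let a group `G`
act on an abelian group `M` with `g² = 1` on `M` for every `g ∈ G`, and let `0 ≠ Q ∈ M` generate a
proper subgroup. Then some proper non-zero subgroup of `M` is `G`-stable: if every `g` acts as
`+1` or as `-1`, the cyclic subgroup `ℤ Q` is stable; otherwise some `g` moves some `x` and does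
not negate some `y`, the action is commutative (a group of exponent `2` is abelian:
`(ab)z = (bb)(ab)z = b(aa)b(ab)z = (ba)(abab)z = (ba)z`), and the subgroup `{z | g z = -z}` is
stable, contains `x - g x ≠ 0` and misses `y`. (The linear algebra behind "`E(K)[p] = 0` for a
quadratic field `K` when `E[p]` is irreducible".) [folklore] -/
theorem exists_stable_addSubgroup_of_sq_smul_eq {G M : Type*} [Group G] [AddCommGroup M]
    [DistribMulAction G M] (hsq : ∀ (g : G) (x : M), (g * g) • x = x) {Q : M} (hQ : Q ≠ 0)
    (hproper : AddSubgroup.zmultiples Q ≠ ⊤) :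
    ∃ H : AddSubgroup M, (∀ g : G, ∀ x ∈ H, g • x ∈ H) ∧ H ≠ ⊥ ∧ H ≠ ⊤ := by
  by_cases hall : ∀ g : G, (∀ x : M, g • x = x) ∨ (∀ x : M, g • x = -x)
  · refine ⟨AddSubgroup.zmultiples Q, fun g x hx ↦ ?_, fun hbot ↦ hQ ?_, hproper⟩
    · rcases hall g with h | h
      · rw [h]; exact hx
      · rw [h]; exact neg_mem hx
    · have hmem : Q ∈ AddSubgroup.zmultiples Q := AddSubgroup.mem_zmultiples Q
      rw [hbot] at hmem
      exact (AddSubgroup.mem_bot).mp hmem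
  · push Not at hall
    obtain ⟨g, ⟨x, hx⟩, ⟨y, hy⟩⟩ := hall
    -- a group acting through involutions acts commutatively
    have comm : ∀ (a b : G) (z : M), (a * b) • z = (b * a) • z := by
      intro a b z
      have key : b * (a * a) * b * (a * b) = b * a * (a * b * (a * b)) := by group
      calc (a * b) • z = (b * b) • ((a * b) • z) := (hsq b _).symm
        _ = b • ((a * a) • (b • ((a * b) • z))) := by rw [hsq a, mul_smul]
        _ = (b * (a * a) * b * (a * b)) • z := by simp only [mul_smul]
        _ = (b * a * (a * b * (a * b))) • z := by rw [key]
        _ = (b * a) • z := by rw [mul_smul, hsq (a * b)]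
    let H : AddSubgroup M :=
      { carrier := {z | g • z = -z}
        zero_mem' := by
          show g • (0 : M) = -0
          rw [smul_zero, neg_zero]
        add_mem' := by
          intro u v hu hv
          show g • (u + v) = -(u + v)
          rw [smul_add, (hu : g • u = -u), (hv : g • v = -v), neg_add]
        neg_mem' := by
          intro u hu
          show g • (-u) = - -u
          rw [smul_neg, (hu : g • u = -u)] }
    refine ⟨H, fun h z hz ↦ ?_, fun hbot ↦ ?_, fun htop ↦ ?_⟩
    · show g • h • z = -(h • z)
      rw [← mul_smul, comm, mul_smul, (hz : g • z = -z), smul_neg]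
    · have hz₀ : x - g • x ∈ H := by
        show g • (x - g • x) = -(x - g • x)
        rw [smul_sub, ← mul_smul, hsq, neg_sub]
      rw [hbot, AddSubgroup.mem_bot, sub_eq_zero] at hz₀
      exact hx hz₀.symm
    · have hy' : y ∈ H := htop ▸ AddSubgroup.mem_top y
      exact hy hy'

end Abstract

section Torsion

variable (K : Type) [Field K] [NumberField K] (W : WeierstrassCurve ℚ) [W.IsElliptic]

/-- **`E(K)[p] = 0` for a quadratic number field `K` (in `Type`) when `E[p]` is an irreducible
`Γ_ℚ`-module** — the hypothesis (tor) of Burungale–Castella–Grossi–Skinner, Thm. 1, from their (irr)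
alone. Argument (standard; Gross 1991, §2 gives the surjective case): pull a `K`-rational
`p`-torsion point back to `0 ≠ Q ∈ E[p] = E(ℚ̄)[p]` along the tree's identification `E(ℚ̄) ≅ E(K̄)`
(`pointsMap`, bijective and `res`-equivariant); `Q` is fixed by `res(Γ_K)`, hence by every square of
`Γ_ℚ` (`exists_resGal_eq_mul_self`: `[K : ℚ] = 2`). The subgroup of `E[p]` fixed by all squares is
`Γ_ℚ`-stable (squares form a normal subset) and contains `Q`, so by (irr) it is all of `E[p]`:
`Γ_ℚ` acts on `E[p]` through involutions. Since `#E[p] = p²` (`card_torsionPoints_eq_sq_holds`) and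
`p Q = 0`, `ℤ Q` is proper, and `exists_stable_addSubgroup_of_sq_smul_eq` produces a proper non-zero
stable subgroup, contradicting (irr). No parity condition on `p` is needed.
[cite: GrossLMS1991, §2 (sentence after (2.2))] [cite: BurungaleEtAl2026, Thm. 1 (hypotheses (tor), (irr))] -/
theorem torsionBy_eq_bot_of_hasIrreducibleModPGaloisRep_type (hK : Module.finrank ℚ K = 2)
    {p : ℕ} (hp : p.Prime) (hirr : W.HasIrreducibleModPGaloisRep p) :
    AddSubgroup.torsionBy (W.baseChange K).toAffine.Point (p : ℤ) = ⊥ := by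
  rw [eq_bot_iff]
  intro P hP
  rw [AddSubgroup.mem_bot]
  by_contra hP0
  have hPp : p • P = 0 := AddSubgroup.torsionBy.nsmul_iff.mp hP
  -- the point over `K̄` and its preimage `Q` over `ℚ̄`
  let f : K →ₐ[ℚ] AlgebraicClosure K := (algebraMap K (AlgebraicClosure K)).toRatAlgHom
  let φ : (W.baseChange K).toAffine.Point →+ localPoints W K :=
    WeierstrassCurve.Affine.Point.map f
  have hφ : Function.Injective φ := WeierstrassCurve.Affine.Point.map_injective _
  obtain ⟨Q, hQ⟩ := (pointsMapOfEmb_bijective K W (closureEmb (K := ℚ) K)).2 (φ P)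
  have hQ' : pointsMap W K Q = φ P := hQ
  have hinj : Function.Injective (pointsMap W K) :=
    (pointsMapOfEmb_bijective K W (closureEmb (K := ℚ) K)).1
  have hQ0 : Q ≠ 0 := by
    rintro rfl
    apply hP0
    apply hφ
    rw [map_zero, ← hQ', map_zero]
  have hQp : p • Q = 0 := by
    apply hinj
    rw [map_nsmul, map_zero, hQ', ← map_nsmul, hPp, map_zero]
  -- `Q` is fixed by `Γ_K`
  have hfixK : ∀ τ : absoluteGaloisGroup K, resGal (K := ℚ) K τ • Q = Q := by
    intro τ
    apply hinj
    rw [pointsMap_smul, hQ']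
    change WeierstrassCurve.Affine.Point.map
        ((AlgEquiv.restrictScalars ℚ (toAlgEquiv K τ) :
            AlgebraicClosure K ≃ₐ[ℚ] AlgebraicClosure K) :
          AlgebraicClosure K →ₐ[ℚ] AlgebraicClosure K)
        (WeierstrassCurve.Affine.Point.map f P) =
      WeierstrassCurve.Affine.Point.map f P
    have hgf : ((AlgEquiv.restrictScalars ℚ (toAlgEquiv K τ) :
            AlgebraicClosure K ≃ₐ[ℚ] AlgebraicClosure K) :
          AlgebraicClosure K →ₐ[ℚ] AlgebraicClosure K).comp f = f := by
      ext x
      exact (toAlgEquiv K τ).commutes x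
    rw [WeierstrassCurve.Affine.Point.map_map, hgf]
  -- hence by all squares of `Γ_ℚ`
  have hsq : ∀ σ : absoluteGaloisGroup ℚ, (σ * σ) • Q = Q := by
    intro σ
    obtain ⟨τ, hτ⟩ := exists_resGal_eq_mul_self K hK σ
    rw [← hτ]
    exact hfixK τ
  -- the Galois module `E[p]`, of order `p²`
  haveI : Fact p.Prime := ⟨hp⟩
  let M := ↥(WeierstrassCurve.geomTorsion W (p : ℤ))
  have hcardM : Nat.card M = p ^ 2 := by
    have := WeierstrassCurve.card_torsionPoints_eq_sq_holds W (AlgebraicClosure ℚ) (n := p)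
      (by exact_mod_cast hp.ne_zero)
    exact this
  let Qm : M := ⟨Q, AddSubgroup.torsionBy.nsmul_iff.mpr hQp⟩
  have hQm0 : Qm ≠ 0 := fun h ↦ hQ0 (congrArg Subtype.val h)
  have hpQm : p • Qm = 0 := Subtype.ext hQp
  -- the subgroup fixed by all squares is stable and contains `Q`, hence is everything
  let H₁ : AddSubgroup M :=
    { carrier := {R | ∀ σ : absoluteGaloisGroup ℚ, (σ * σ) • R = R}
      zero_mem' := fun σ ↦ smul_zero _
      add_mem' := by
        intro u v hu hv σ
        rw [smul_add, hu σ, hv σ]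
      neg_mem' := by
        intro u hu σ
        rw [smul_neg, hu σ] }
  have hH₁stab : ∀ σ : absoluteGaloisGroup ℚ, ∀ R ∈ H₁, σ • R ∈ H₁ := by
    intro τ R hR σ
    show (σ * σ) • τ • R = τ • R
    have hconj : σ * σ * τ = τ * (τ⁻¹ * σ * τ * (τ⁻¹ * σ * τ)) := by group
    rw [← mul_smul, hconj, mul_smul, hR]
  have hQmH₁ : Qm ∈ H₁ := fun σ ↦ Subtype.ext (hsq σ)
  have hirr' : ∀ H : AddSubgroup M,
      (∀ σ : absoluteGaloisGroup ℚ, ∀ R ∈ H, σ • R ∈ H) → H = ⊥ ∨ H = ⊤ := hirr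
  have hH₁top : H₁ = ⊤ := by
    refine (hirr' H₁ hH₁stab).resolve_left fun hbot ↦ hQm0 ?_
    rw [hbot] at hQmH₁
    exact (AddSubgroup.mem_bot).mp hQmH₁
  have hsqM : ∀ (σ : absoluteGaloisGroup ℚ) (R : M), (σ * σ) • R = R := by
    intro σ R
    have hR : R ∈ H₁ := hH₁top ▸ AddSubgroup.mem_top R
    exact hR σ
  -- `ℤ Q` is proper: `#ℤQ = ord Q ∣ p < p² = #E[p]`
  have hproper : AddSubgroup.zmultiples Qm ≠ ⊤ := by
    intro htop
    have h1 : Nat.card (AddSubgroup.zmultiples Qm) = addOrderOf Qm := Nat.card_zmultiples Qm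
    rw [htop, AddSubgroup.card_top, hcardM] at h1
    have hle : addOrderOf Qm ≤ p := Nat.le_of_dvd hp.pos (addOrderOf_dvd_of_nsmul_eq_zero hpQm)
    have h2 : p ^ 2 ≤ p := h1 ▸ hle
    have h3 : p < p ^ 2 := by
      calc p = p ^ 1 := (pow_one p).symm
        _ < p ^ 2 := Nat.pow_lt_pow_right hp.one_lt (by norm_num)
    omega
  obtain ⟨H, hHstab, hHbot, hHtop⟩ := exists_stable_addSubgroup_of_sq_smul_eq hsqM hQm0 hproper
  rcases hirr' H hHstab with h | h
  · exact hHbot h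
  · exact hHtop h

end Torsion

section TorsionUniverse

/-- **`E(K)[p] = 0` for a quadratic number field `K` when `E[p]` is irreducible**, for `K` in any
universe: `torsionBy_eq_bot_of_hasIrreducibleModPGaloisRep_type` for a `ℚ`-isomorphic model of
`K` in `Type` (`exists_algEquiv_numberField_type`), transported by `torsionBy_eq_bot_of_algEquiv`.
[cite: GrossLMS1991, §2 (sentence after (2.2))] [cite: BurungaleEtAl2026, Thm. 1 (hypotheses (tor), (irr))] -/
theorem torsionBy_eq_bot_of_hasIrreducibleModPGaloisRep (W : WeierstrassCurve ℚ) [W.IsElliptic]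
    (K : Type u) [Field K] [NumberField K] (hK : Module.finrank ℚ K = 2) {p : ℕ} (hp : p.Prime)
    (hirr : W.HasIrreducibleModPGaloisRep p) :
    AddSubgroup.torsionBy (W.baseChange K).toAffine.Point (p : ℤ) = ⊥ := by
  obtain ⟨K₀, _, _, ⟨e⟩⟩ := exists_algEquiv_numberField_type K
  have hK₀ : Module.finrank ℚ K₀ = 2 := by rw [← hK]; exact e.toLinearEquiv.finrank_eq
  exact torsionBy_eq_bot_of_algEquiv W e
    (torsionBy_eq_bot_of_hasIrreducibleModPGaloisRep_type K₀ W hK₀ hp hirr)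

/-- The same for an imaginary quadratic field (`Literature.IsImaginaryQuadratic K`; only
`[K : ℚ] = 2` is used) — hypothesis (tor) of BCGS Thm. 1 from hypothesis (irr).
[cite: BurungaleEtAl2026, Thm. 1 (hypotheses (tor), (irr))] -/
theorem torsionBy_eq_bot_of_isImaginaryQuadratic_of_hasIrreducibleModPGaloisRep
    (W : WeierstrassCurve ℚ) [W.IsElliptic] (K : Type u) [Field K] [NumberField K]
    (hK : IsImaginaryQuadratic K) {p : ℕ} (hp : p.Prime) (hirr : W.HasIrreducibleModPGaloisRep p) :
    AddSubgroup.torsionBy (W.baseChange K).toAffine.Point (p : ℤ) = ⊥ :=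
  torsionBy_eq_bot_of_hasIrreducibleModPGaloisRep W K hK.1 hp hirr

/-! ## Part 2. (irr) and (tor) for CM curves at a good ordinary `p ≥ 5` -/

/-- **(tor) for CM curves: `E(K)[p] = 0` over every quadratic field `K`** for a CM curve `E/ℚ`
(globally minimal `W`, to read `a_p`) and a prime `p ≥ 5` of good ordinary reduction — from Serre's
irreducibility of `E[p]` for such `(E, p)` (tree theorem
`hasIrreducibleModPGaloisRep_of_hasCM_of_five_le`, Serre 1972, §4.5) and Part 1.
[cite: Serre1972, §4.5 and §1.11] [cite: BurungaleEtAl2026, Thm. 1 (hypotheses (tor), (irr))] -/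
theorem torsionBy_baseChange_eq_bot_of_hasCM_of_five_le (W : WeierstrassCurve ℚ) [W.IsElliptic]
    [W.IsGloballyMinimal] (hCM : W.HasCM) (K : Type u) [Field K] [NumberField K]
    (hK : Module.finrank ℚ K = 2) (p : ℕ) [Fact p.Prime] (hp : 5 ≤ p)
    (hgood : W.HasGoodReductionAtPrime p) (hord : ¬ (p : ℤ) ∣ W.frobeniusTrace p) :
    AddSubgroup.torsionBy (W.baseChange K).toAffine.Point (p : ℤ) = ⊥ :=
  torsionBy_eq_bot_of_hasIrreducibleModPGaloisRep W K hK Fact.out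
    (W.hasIrreducibleModPGaloisRep_of_hasCM_of_five_le hCM p hp hgood hord)

end TorsionUniverse

/-! ## Part 3. Route B: Burungale–Tian's Thm. 1.2 from BCGS Cor. 1 over a Hoffstein–Luo field -/

section RouteB

/-- **Route B from the sign onwards** (Yan–Zhu, proof of Thm. 4.15, §4.6, run for a CM curve with
Burungale–Castella–Grossi–Skinner's Cor. 1 as the `K`-level leaf). For `E/ℚ` with complex
multiplication (globally minimal `W`), a prime `p ≥ 5` of good ordinary reduction, `w(E) = -1` and
`corank_{ℤ_p} Sel_{p^∞}(E/ℚ) = 1`: (b) take `K` imaginary quadratic with every `ℓ ∣ N_E` split,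
`p` split, `d_K ≡ 1 (mod 8)` (so (disc): `d_K` odd, `≠ -3`) and `L(E^{(d_K)}, 1) ≠ 0` from the
Modularity Theorem (`hmod`) and Hoffstein–Luo (`hHL`),
`exists_heegnerField_split_twist_ne_zero_discr_emod_eight_of_hoffsteinLuo`; (c) Kato (`hKato`):
`Sel_{p^∞}(E^{(d_K)}/ℚ)` is finite, of corank `0`; (d) `corank Sel_{p^∞}(E/K) = 1 + 0`
(`selmerCorank_baseChange_quadratic_holds`); (irr) by Serre for CM curves
(`hasIrreducibleModPGaloisRep_of_hasCM_of_five_le`) and (tor) by Part 2; (e'') BCGS Thm. 1 +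
Cor. 1, rank-one case, as printed (`hBCGS`, the rendering of `BSDSelmerPConverseYanZhuProofs`:
`p > 3` good ordinary, (irr), `K` imaginary quadratic with (Heeg) for `N = W.conductorNorm ℤ`,
(disc), (tor), `p` split, corank one over `K` ⟹ `analyticRankEK W K = 1`, i.e.
`ord_{s=1} L(E/K, s) = 1`); (f) `ord L(E/K) = ord L(E) + ord L(E^{(d_K)}) = ord L(E) + 0`
(`analyticRankEK_eq_add_of` from modularity, `analyticRank_eq_zero_of_entireLFunction_one_ne_zero`).
[cite: BurungaleEtAl2026, Thm. 1 and Cor. 1 (arXiv:2312.09301, §0.1, pp. 3–4)]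
[cite: BurungaleTian2019, Thm. 1.2 (p. 214)] [cite: YanZhu2024MainConjNonCM, Thm. 4.15 (proof, §4.6)]
[cite: HoffsteinLuo1997, Theorem (§1, pp. 435–436)] [cite: Kato2004Asterisque, Cor. 14.3 (p. 235)] -/
theorem analyticRank_eq_one_of_hasCM_of_bcgs_of_rootNumber_eq_neg_one
    (hmod : ModularForms.exists_isNewformOf) (hHL : HoffsteinLuo1997_exists_twist_L_one_ne_zero)
    (hKato : ∀ (W : WeierstrassCurve ℚ) [W.IsElliptic] (p : ℕ) [Fact p.Prime],
      kato_finite_of_L_one_ne_zero W p)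
    (hBCGS : ∀ (W : WeierstrassCurve ℚ) [W.IsElliptic] [W.IsGloballyMinimal] (p : ℕ) [Fact p.Prime],
      3 < p → W.HasGoodReductionAtPrime p → ¬ (p : ℤ) ∣ W.frobeniusTrace p →
      W.HasIrreducibleModPGaloisRep p →
      ∀ (K : Type) [Field K] [NumberField K], IsImaginaryQuadratic K →
        SatisfiesHeegnerHypothesis (W.conductorNorm ℤ) K →
        Odd (NumberField.discr K) → NumberField.discr K ≠ -3 →
        AddSubgroup.torsionBy (W.baseChange K).toAffine.Point (p : ℤ) = ⊥ →
        SatisfiesHeegnerHypothesis p K →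
        (W.baseChange K).selmerCorank p = 1 → analyticRankEK W K = 1)
    (W : WeierstrassCurve ℚ) [W.IsElliptic] [W.IsGloballyMinimal] (hCM : W.HasCM) (p : ℕ)
    [Fact p.Prime] (hp : 5 ≤ p) (hgood : W.HasGoodReductionAtPrime p)
    (hord : ¬ (p : ℤ) ∣ W.frobeniusTrace p) (hw : W.rootNumber = -1)
    (hcorank : W.selmerCorank p = 1) : W.analyticRank = 1 := by
  have hpP : p.Prime := Fact.out
  -- (b) the auxiliary imaginary quadratic field, from Hoffstein–Luo, with `d_K ≡ 1 (mod 8)`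
  obtain ⟨K, _, _, hK, -, hHN, hHp, hd8, hL1⟩ :=
    exists_heegnerField_split_twist_ne_zero_discr_emod_eight_of_hoffsteinLuo hmod hHL W hw hpP 0
  -- (disc): `d_K` odd and `d_K ≠ -3`
  have hodd : Odd (NumberField.discr K) := Int.odd_iff.mpr (by omega)
  have hne3 : NumberField.discr K ≠ -3 := by omega
  -- (c) Kato: the `p^∞`-Selmer group of the twist is finite, hence of corank `0`
  have hd : (NumberField.discr K : ℚ) ≠ 0 := by exact_mod_cast NumberField.discr_ne_zero K
  haveI := W.isElliptic_quadraticTwist hd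
  obtain ⟨-, -, hfin⟩ := hKato (W.quadraticTwist (NumberField.discr K : ℚ)) p hL1
  haveI := hfin
  have h0 : (W.quadraticTwist (NumberField.discr K : ℚ)).selmerCorank p = 0 :=
    (W.quadraticTwist (NumberField.discr K : ℚ)).selmerCorank_eq_zero_of_finite p
  -- (d) the corank over `K` is `1 + 0 = 1`
  have hK1 : (W.baseChange K).selmerCorank p = 1 := by
    rw [selmerCorank_baseChange_quadratic_holds W K hK.1 p, hcorank, h0]
  -- (irr) by Serre for CM curves, (tor) by Part 2
  have hirr : W.HasIrreducibleModPGaloisRep p :=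
    W.hasIrreducibleModPGaloisRep_of_hasCM_of_five_le hCM p hp hgood hord
  have htor : AddSubgroup.torsionBy (W.baseChange K).toAffine.Point (p : ℤ) = ⊥ :=
    torsionBy_eq_bot_of_hasIrreducibleModPGaloisRep W K hK.1 hpP hirr
  -- (e'') Burungale–Castella–Grossi–Skinner, Cor. 1 (rank-one case) over this `K`
  have hEK : analyticRankEK W K = 1 :=
    hBCGS W p (by omega) hgood hord hirr K hK hHN hodd hne3 htor hHp hK1
  -- (f) factorisation of the analytic rank over `K`
  rw [analyticRankEK_eq_add_of (hasEntireLFunction_rat_of_exists_isNewformOf hmod) W K,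
    analyticRank_eq_zero_of_entireLFunction_one_ne_zero _ hL1, add_zero] at hEK
  exact hEK

/-- **Burungale–Tian's Thm. 1.2 along route B**: the named fact
`burungaleTian_analyticRank_eq_one_of_selmerCorank_eq_one_of_hasCM` follows from (a) the `p`-parity
theorem (`hpar`, tree fact `p_parity`: `(-1)^{corank} = w(E)`, so corank `1` gives `w(E) = -1`),
the Modularity Theorem (`hmod`), Hoffstein–Luo 1997 (`hHL`), Kato's finiteness theorem (`hKato`)
and Burungale–Castella–Grossi–Skinner, Thm. 1 + Cor. 1 (rank-one case) as printed (`hBCGS`), by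
`analyticRank_eq_one_of_hasCM_of_bcgs_of_rootNumber_eq_neg_one`. Along this decomposition the
fact rests on exactly the leaves of the tree's second decomposition of Yan–Zhu's Cor. 1.4
(`yanZhu_analyticRank_eq_one_of_selmerCorank_eq_one_of_bcgs`), the image hypotheses (irr), (tor)
of the `K`-level leaf being theorems for CM curves.
[cite: BurungaleTian2019, Thm. 1.2 (p. 214)]
[cite: BurungaleEtAl2026, Thm. 1 and Cor. 1 (arXiv:2312.09301, §0.1, pp. 3–4)]
[cite: DokchitserDokchitserAnnals2010, Thm. 1.4] [cite: YanZhu2024MainConjNonCM, Thm. 4.15 (proof, §4.6)] -/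
theorem burungaleTian_analyticRank_eq_one_of_selmerCorank_eq_one_of_hasCM_of_bcgs
    (hpar : ∀ (W : WeierstrassCurve ℚ) [W.IsElliptic] (p : ℕ) [Fact p.Prime], p_parity W p)
    (hmod : ModularForms.exists_isNewformOf) (hHL : HoffsteinLuo1997_exists_twist_L_one_ne_zero)
    (hKato : ∀ (W : WeierstrassCurve ℚ) [W.IsElliptic] (p : ℕ) [Fact p.Prime],
      kato_finite_of_L_one_ne_zero W p)
    (hBCGS : ∀ (W : WeierstrassCurve ℚ) [W.IsElliptic] [W.IsGloballyMinimal] (p : ℕ) [Fact p.Prime],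
      3 < p → W.HasGoodReductionAtPrime p → ¬ (p : ℤ) ∣ W.frobeniusTrace p →
      W.HasIrreducibleModPGaloisRep p →
      ∀ (K : Type) [Field K] [NumberField K], IsImaginaryQuadratic K →
        SatisfiesHeegnerHypothesis (W.conductorNorm ℤ) K →
        Odd (NumberField.discr K) → NumberField.discr K ≠ -3 →
        AddSubgroup.torsionBy (W.baseChange K).toAffine.Point (p : ℤ) = ⊥ →
        SatisfiesHeegnerHypothesis p K →
        (W.baseChange K).selmerCorank p = 1 → analyticRankEK W K = 1) :
    burungaleTian_analyticRank_eq_one_of_selmerCorank_eq_one_of_hasCM := by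
  intro W _ _ hCM p _ hp hgood hord hcorank
  -- (a) parity: the root number is `-1`
  have hw : W.rootNumber = -1 := by
    have h := hpar W p
    unfold p_parity at h
    rw [hcorank, pow_one] at h
    exact h.symm
  exact analyticRank_eq_one_of_hasCM_of_bcgs_of_rootNumber_eq_neg_one hmod hHL hKato hBCGS W hCM p
    hp hgood hord hw hcorank

/-- **Route B with Gross–Zagier–Kolyvagin over `ℚ` in place of Kato**: leaf (c) (finiteness of
`Sel_{p^∞}(E^{(d_K)}/ℚ)` from `L(E^{(d_K)}, 1) ≠ 0`) is also supplied by the rank part of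
Gross–Zagier–Kolyvagin (tree fact `rank_eq_analyticRank_of_analyticRank_le_one`, through the tree
reduction `kato_finite_of_L_one_ne_zero_of_rank_eq_analyticRank`).
[cite: BurungaleTian2019, Thm. 1.2 (p. 214)]
[cite: BurungaleEtAl2026, Thm. 1 and Cor. 1 (arXiv:2312.09301, §0.1, pp. 3–4)] -/
theorem burungaleTian_analyticRank_eq_one_of_selmerCorank_eq_one_of_hasCM_of_bcgs_of_rank_eq_analyticRank
    (hpar : ∀ (W : WeierstrassCurve ℚ) [W.IsElliptic] (p : ℕ) [Fact p.Prime], p_parity W p)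
    (hmod : ModularForms.exists_isNewformOf) (hHL : HoffsteinLuo1997_exists_twist_L_one_ne_zero)
    (hGZK : rank_eq_analyticRank_of_analyticRank_le_one)
    (hBCGS : ∀ (W : WeierstrassCurve ℚ) [W.IsElliptic] [W.IsGloballyMinimal] (p : ℕ) [Fact p.Prime],
      3 < p → W.HasGoodReductionAtPrime p → ¬ (p : ℤ) ∣ W.frobeniusTrace p →
      W.HasIrreducibleModPGaloisRep p →
      ∀ (K : Type) [Field K] [NumberField K], IsImaginaryQuadratic K →
        SatisfiesHeegnerHypothesis (W.conductorNorm ℤ) K →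
        Odd (NumberField.discr K) → NumberField.discr K ≠ -3 →
        AddSubgroup.torsionBy (W.baseChange K).toAffine.Point (p : ℤ) = ⊥ →
        SatisfiesHeegnerHypothesis p K →
        (W.baseChange K).selmerCorank p = 1 → analyticRankEK W K = 1) :
    burungaleTian_analyticRank_eq_one_of_selmerCorank_eq_one_of_hasCM :=
  burungaleTian_analyticRank_eq_one_of_selmerCorank_eq_one_of_hasCM_of_bcgs hpar hmod hHL
    (fun W _ p _ ↦ kato_finite_of_L_one_ne_zero_of_rank_eq_analyticRank W p hGZK) hBCGS

/-- **Route B over the common leaf set of the bsd.S19/S20/S25 cluster**: the sign `w(E) = -1` for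
the odd prime `p` from the Modularity Theorem (`hmod`), Waldspurger's twist via Hoffstein–Luo,
Murty–Murty (`hMM`), Gross–Zagier–Kolyvagin over `ℚ` (`hGZK`, which also yields leaf (c)) and
Dokchitser–Dokchitser's base-change parity `rk_p(E/M₀)` odd (`hDD`) —
`rootNumber_eq_neg_one_of_selmerCorank_eq_one_of_facts` — instead of the `p`-parity fact; then
`analyticRank_eq_one_of_hasCM_of_bcgs_of_rootNumber_eq_neg_one`. So along route B Burungale–Tian's
Thm. 1.2 rests on exactly: Modularity, Hoffstein–Luo, Murty–Murty, Gross–Zagier–Kolyvagin over `ℚ`,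
Dokchitser–Dokchitser's `rk_p` parity, and BCGS Cor. 1 — the leaf set of
`yanZhu_analyticRank_eq_one_of_selmerCorank_eq_one_of_bcgs_of_exists_isNewformOf`.
[cite: BurungaleTian2019, Thm. 1.2 (p. 214)]
[cite: BurungaleEtAl2026, Thm. 1 and Cor. 1 (arXiv:2312.09301, §0.1, pp. 3–4)]
[cite: DokchitserDokchitserAnnals2010, Thm. 1.4 and §4.6] -/
theorem burungaleTian_analyticRank_eq_one_of_selmerCorank_eq_one_of_hasCM_of_bcgs_of_exists_isNewformOf
    (hmod : ModularForms.exists_isNewformOf) (hHL : HoffsteinLuo1997_exists_twist_L_one_ne_zero)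
    (hMM : murtyMurty_exists_heegnerField_twist_simpleZero_of_rootNumber_eq_one)
    (hGZK : rank_eq_analyticRank_of_analyticRank_le_one)
    (hDD : dokchitser_selmerCorank_baseChange_mod_two_eq)
    (hBCGS : ∀ (W : WeierstrassCurve ℚ) [W.IsElliptic] [W.IsGloballyMinimal] (p : ℕ) [Fact p.Prime],
      3 < p → W.HasGoodReductionAtPrime p → ¬ (p : ℤ) ∣ W.frobeniusTrace p →
      W.HasIrreducibleModPGaloisRep p →
      ∀ (K : Type) [Field K] [NumberField K], IsImaginaryQuadratic K →
        SatisfiesHeegnerHypothesis (W.conductorNorm ℤ) K →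
        Odd (NumberField.discr K) → NumberField.discr K ≠ -3 →
        AddSubgroup.torsionBy (W.baseChange K).toAffine.Point (p : ℤ) = ⊥ →
        SatisfiesHeegnerHypothesis p K →
        (W.baseChange K).selmerCorank p = 1 → analyticRankEK W K = 1) :
    burungaleTian_analyticRank_eq_one_of_selmerCorank_eq_one_of_hasCM := by
  intro W _ _ hCM p _ hp hgood hord hcorank
  exact analyticRank_eq_one_of_hasCM_of_bcgs_of_rootNumber_eq_neg_one hmod hHL
    (fun W _ p _ ↦ kato_finite_of_L_one_ne_zero_of_rank_eq_analyticRank W p hGZK) hBCGS W hCM p hp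
    hgood hord
    (rootNumber_eq_neg_one_of_selmerCorank_eq_one_of_facts hmod
      (waldspurger_exists_heegnerField_twist_ne_zero_of_hoffsteinLuo hmod hHL) hMM hGZK hDD W p
      (by omega) hcorank)
    hcorank

end RouteB

/-! ## Part 4. The `K`-level leaf one level down: descent from the rational main conjecture,
## off Howard's locus

`BSDSelmerPConverseHeegnerIndexZeroProofs` and `BSDSelmerPConverseHeegnerSpecializationProofs` run
the descent "rational Heegner point main conjecture + corank one over `K` ⟹ the Heegner-module
index vanishes ⟹ the `Λ`-adic Heegner class is `J`-indivisible ⟹ `y_K` has infinite order ⟹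
`ord_{s=1} L(E/K, s) = 1`" on the tree's anticyclotomic objects (`LambdaAdicSelmerData`,
`HeegnerFamily`, `heegnerModule`, `SelmerDualData` of `HeegnerModuleIndex`), but extract the
module-theoretic inputs from Howard's Thm. B and Thm. 3.3.7 as vendored (`Howard2004_thmB`,
`Howard2004_heegnerModule_free`), i.e. under `HowardHypotheses` — among which
"`Γ_K → Aut_{ℤ_p}(T_p E)` is surjective", never satisfied by a CM curve (its `p`-adic image
normalises a Cartan subgroup). The theorems below take those inputs as HYPOTHESES ON THE MODULES
instead — `S = 𝔖_p(K_∞)` finitely generated, torsion-free and of `Λ`-rank one, `𝒳` of `Λ`-rank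
one, `ℋ_∞` free of rank one — which is the shape in which Burungale–Castella–Skinner, IMRN 2025 =
arXiv:2405.00270, Thm. 1.2.2 (a) prints them for EVERY `E/ℚ` at a good ordinary `p > 3` with
(irr_ℚ) and every `K` with (disc), (Heeg), (spl): "both `X_ord(E/K_∞^-)` and `H¹_{F_Λ}(K, T)` have
`Λ_K^-`-rank one, and `ch_{Λ_K^-}(X_ord(E/K_∞^-)_tor) = ch_{Λ_K^-}(H¹_{F_Λ}(K, T)/(κ₁^Heeg))²` in
`Λ_K^- ⊗ ℚ_p`" (the freeness of `Λ κ₁^Heeg = ℋ_∞`, Howard's Thm. 3.3.7, being Cornut–Vatsal with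
Perrin-Riou's Prop. 10, printed for every `E/ℚ` under the Heegner hypothesis). The proofs are
those of the two sibling files verbatim, minus the extraction step; nothing is asserted. -/

section OffHowardLocus

open IwasawaAlgebra

variable {N : ℕ} [NeZero N] {W : WeierstrassCurve ℚ} {K : Type u} [Field K] [NumberField K]
  {p : ℕ} [Fact p.Prime] {κ : ZpExtension K p} {γ : Field.absoluteGaloisGroup K}
  {jbar : AlgebraicClosure K →+* ℂ}

/-- **`S/ℋ_∞` is `Λ`-torsion** when `S` has rank one and `ℋ_∞ ⊆ S` has rank one (rank–nullity
over the domain `Λ`; Perrin-Riou 1987, §1 p. 405: "`I(H_∞)` … est non nul si et seulement si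
`H_∞` et `𝔖_p(D_∞)` sont de même rang égal à `1`"), module-theoretic form of
`isTorsion_quotient_heegnerModule`. [cite: PerrinRiou1987BSMF, §1 p. 405] -/
theorem isTorsion_quotient_heegnerModule_of_finrank
    (D : (W.baseChange K).LambdaAdicSelmerData κ γ) (F : HeegnerFamily N W K κ jbar)
    [Module.Finite (IwasawaAlgebra p) D.S]
    (hS1 : Module.finrank (IwasawaAlgebra p) D.S = 1)
    (hH1 : Module.finrank (IwasawaAlgebra p) (heegnerModule D F) = 1) :
    Module.IsTorsion (IwasawaAlgebra p) (D.S ⧸ heegnerModule D F) := by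
  have hS : Module.rank (IwasawaAlgebra p) D.S = 1 := by
    rw [← Module.finrank_eq_rank, hS1, Nat.cast_one]
  have hk : (1 : Cardinal) ≤ Module.rank (IwasawaAlgebra p) (heegnerModule D F) :=
    Cardinal.one_le_iff_ne_zero.mpr fun h0 ↦ by simp [Module.finrank, h0] at hH1
  have hsum := rank_quotient_add_rank_of_isDomain (heegnerModule D F)
  have hq0 : Module.rank (IwasawaAlgebra p) (D.S ⧸ heegnerModule D F) = 0 := by
    by_contra hne
    have h1 : (1 : Cardinal) ≤ Module.rank (IwasawaAlgebra p) (D.S ⧸ heegnerModule D F) :=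
      Cardinal.one_le_iff_ne_zero.mpr hne
    have h2 : (1 : Cardinal) + 1 ≤ Module.rank (IwasawaAlgebra p) D.S := hsum ▸ add_le_add h1 hk
    rw [hS] at h2
    norm_num at h2
  exact rank_eq_zero_iff_isTorsion.mp hq0

/-- **The Heegner-module index vanishes, `a(E, K, p) = ord_J I(ℋ_∞) = 0`, off Howard's locus**:
module-theoretic form of `heegnerModuleIndex_eq_zero_of_rational_mainConjecture`. Inputs: `S`
finitely generated of rank one and `ℋ_∞` of rank one (`hS1`, `hH1`); `𝒳` finitely generated of
rank one (`hX1`); the rational Heegner point main conjecture in the direction opposite to Howard's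
(c), `c · char(𝒳_{Λ-tors}) ⊆ I(ℋ_∞)²` with `c ∈ ℤ_p ∖ {0}` (`hMC`; Burungale–Castella–Skinner
Thm. 1.2.2 (a) gives the EQUALITY in `Λ ⊗ ℚ_p`, of which this is one inclusion with denominators
cleared); `rank_{ℤ_p} 𝒳/J𝒳 ≤ 1` (`hctl`, Mazur's control theorem with corank one over `K`).
[cite: BurungaleCastellaSkinner2025, Thm. 1.2.2 (a)]
[cite: YanZhu2024MainConjNonCM, Thm. 4.15 (proof, §4.6) with Thm. 4.12 (2)]
[cite: Howard2004HeegnerKolyvagin, §1 eq. (2)] -/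
theorem heegnerModuleIndex_eq_zero_of_rational_mainConjecture_of_finrank
    (D : (W.baseChange K).LambdaAdicSelmerData κ γ) (F : HeegnerFamily N W K κ jbar)
    (X : (W.baseChange K).SelmerDualData κ γ)
    [Module.Finite (IwasawaAlgebra p) D.S]
    (hS1 : Module.finrank (IwasawaAlgebra p) D.S = 1)
    (hH1 : Module.finrank (IwasawaAlgebra p) (heegnerModule D F) = 1)
    [Module.Finite (IwasawaAlgebra p) X.X] (hX1 : Module.finrank (IwasawaAlgebra p) X.X = 1)
    {c : ℤ_[p]} (hc : c ≠ 0)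
    (hMC : Ideal.span {(PowerSeries.C c : IwasawaAlgebra p)} *
        Module.charIdeal (IwasawaAlgebra p) (Submodule.torsion (IwasawaAlgebra p) X.X) ≤
      heegnerCharIdeal D F ^ 2)
    (hctl : coinvariantsRank p X.X ≤ 1) :
    heegnerModuleIndex D F = 0 := by
  rw [heegnerModuleIndex_eq_lengthAt_primeT]
  exact lengthAt_primeT_eq_zero_of_C_mul_charIdeal_le_sq p
    (Submodule.torsion_isTorsion (R := IwasawaAlgebra p) (M := X.X))
    (isTorsion_quotient_heegnerModule_of_finrank D F hS1 hH1)
    (finite_coinvariants_torsion_of_finrank_eq_one p hX1 hctl) hc hMC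

/-- **`ℋ_∞ = Λ κ_∞` with `κ_∞ ≠ 0`** from "`ℋ_∞` is free of rank one" taken as a hypothesis
(Howard 2004, Thm. 3.3.7 = Cornut–Vatsal with Perrin-Riou 1987, §3.4 Prop. 10, printed for every
`E/ℚ` under the Heegner hypothesis); module-theoretic form of `exists_heegnerModule_eq_span_singleton`.
[cite: Howard2004HeegnerKolyvagin, Thm. 3.3.7] [cite: PerrinRiou1987BSMF, §3.4 Prop. 10] -/
theorem exists_heegnerModule_eq_span_singleton_of_free
    (D : (W.baseChange K).LambdaAdicSelmerData κ γ) (F : HeegnerFamily N W K κ jbar)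
    (hfree : Module.Free (IwasawaAlgebra p) (heegnerModule D F))
    (hH1 : Module.finrank (IwasawaAlgebra p) (heegnerModule D F) = 1) :
    ∃ g : D.S, g ≠ 0 ∧ heegnerModule D F = Submodule.span (IwasawaAlgebra p) {g} := by
  haveI := hfree
  haveI : Module.Finite (IwasawaAlgebra p) (heegnerModule D F) :=
    Module.finite_of_finrank_pos (by omega)
  let b := Module.basisUnique (Fin 1) hH1
  refine ⟨(b default : heegnerModule D F), ?_, ?_⟩
  · intro h0
    have h : (b default : heegnerModule D F) = 0 := by exact_mod_cast h0
    exact b.ne_zero default h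
  · apply le_antisymm
    · intro x hx
      have hmem : (⟨x, hx⟩ : heegnerModule D F) ∈
          Submodule.span (IwasawaAlgebra p) (Set.range b) := b.mem_span _
      rw [Set.range_unique] at hmem
      have h := Submodule.mem_map_of_mem (f := (heegnerModule D F).subtype) hmem
      rwa [Submodule.map_span, Set.image_singleton, Submodule.subtype_apply] at h
    · rw [Submodule.span_le, Set.singleton_subset_iff]
      exact (b default).2

/-- **`p^m κ_∞ ∉ (γ - 1) S` for every generator `κ_∞` of `ℋ_∞` and every `m`, off Howard's
locus** (the image of the `Λ`-adic Heegner class in `S_Γ = S/JS` is not `ℤ_p`-torsion; Wan 2021,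
proof of Thm. 3.17): module-theoretic form of `pow_smul_heegnerGenerator_notMem_TSubmodule` — `S`
torsion-free, `ℓ_𝔭(S/Λκ_∞) = 0` by `heegnerModuleIndex_eq_zero_of_rational_mainConjecture_of_finrank`.
[cite: BurungaleCastellaSkinner2025, Thm. 1.2.2 (a)]
[cite: Wan2021HeegnerPointKolyvaginSystem, Thm. 3.17 (proof, p. 10)]
[cite: YanZhu2024MainConjNonCM, Thm. 4.15 (proof, §4.6)] -/
theorem pow_smul_heegnerGenerator_notMem_TSubmodule_of_finrank
    (D : (W.baseChange K).LambdaAdicSelmerData κ γ) (F : HeegnerFamily N W K κ jbar)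
    (X : (W.baseChange K).SelmerDualData κ γ)
    [Module.Finite (IwasawaAlgebra p) D.S] [NoZeroSMulDivisors (IwasawaAlgebra p) D.S]
    (hS1 : Module.finrank (IwasawaAlgebra p) D.S = 1)
    (hH1 : Module.finrank (IwasawaAlgebra p) (heegnerModule D F) = 1)
    [Module.Finite (IwasawaAlgebra p) X.X] (hX1 : Module.finrank (IwasawaAlgebra p) X.X = 1)
    {c : ℤ_[p]} (hc : c ≠ 0)
    (hMC : Ideal.span {(PowerSeries.C c : IwasawaAlgebra p)} *
        Module.charIdeal (IwasawaAlgebra p) (Submodule.torsion (IwasawaAlgebra p) X.X) ≤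
      heegnerCharIdeal D F ^ 2)
    (hctl : coinvariantsRank p X.X ≤ 1)
    {g : D.S} (hg : heegnerModule D F = Submodule.span (IwasawaAlgebra p) {g}) (m : ℕ) :
    ((p : IwasawaAlgebra p) ^ m) • g ∉ TSubmodule p D.S := by
  have hg0 : g ≠ 0 := by
    intro h0
    rw [h0, Submodule.span_zero_singleton] at hg
    rw [hg, finrank_bot] at hH1
    exact zero_ne_one hH1
  have hidx :=
    heegnerModuleIndex_eq_zero_of_rational_mainConjecture_of_finrank D F X hS1 hH1 hX1 hc hMC hctl
  rw [heegnerModuleIndex_eq_lengthAt_primeT,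
    Module.lengthAt_eq_of_linearEquiv (Submodule.quotEquivOfEq _ _ hg) (primeT p)] at hidx
  exact pow_smul_notMem_TSubmodule_of_lengthAt_eq_zero p hg0 hidx m

/-- **One of `y_K`, `z_0` has infinite order in `E(K̄)`, off Howard's locus**: module-theoretic
form of `exists_mem_generators_zero_not_isOfFinAddOrder` (same proof: a common annihilator `n` of
`y_K`, `z_0` gives `pr_0 (n κ_∞) = 0`, `proj_zero_natCast_smul_eq_zero_of_mem_heegnerModule`, so
`n' n κ_∞ ∈ JS` by the base-layer control `hctl₀` — Perrin-Riou 1987, §2.2, proof of Lemme 5 —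
so `p^a κ_∞ ∈ JS`, contradicting `pow_smul_heegnerGenerator_notMem_TSubmodule_of_finrank`), with
"`ℋ_∞` free of rank one" as the hypothesis `hfree`/`hH1`.
[cite: BurungaleCastellaSkinner2025, Thm. 1.2.2 (a)]
[cite: PerrinRiou1987BSMF, §2.2 (proof of Lemme 5, p. 417) and §3.4 Prop. 10]
[cite: YanZhu2024MainConjNonCM, Thm. 4.15 (proof, §4.6)] -/
theorem exists_mem_generators_zero_not_isOfFinAddOrder_of_finrank
    (D : (W.baseChange K).LambdaAdicSelmerData κ γ) (F : HeegnerFamily N W K κ jbar)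
    (X : (W.baseChange K).SelmerDualData κ γ)
    [Module.Finite (IwasawaAlgebra p) D.S] [NoZeroSMulDivisors (IwasawaAlgebra p) D.S]
    (hS1 : Module.finrank (IwasawaAlgebra p) D.S = 1)
    (hfree : Module.Free (IwasawaAlgebra p) (heegnerModule D F))
    (hH1 : Module.finrank (IwasawaAlgebra p) (heegnerModule D F) = 1)
    [Module.Finite (IwasawaAlgebra p) X.X] (hX1 : Module.finrank (IwasawaAlgebra p) X.X = 1)
    {c : ℤ_[p]} (hc : c ≠ 0)
    (hMC : Ideal.span {(PowerSeries.C c : IwasawaAlgebra p)} *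
        Module.charIdeal (IwasawaAlgebra p) (Submodule.torsion (IwasawaAlgebra p) X.X) ≤
      heegnerCharIdeal D F ^ 2)
    (hctl : coinvariantsRank p X.X ≤ 1)
    (hctl₀ : ∀ s : D.S, D.proj 0 s = 0 →
      ∃ n : ℕ, n ≠ 0 ∧ (n : IwasawaAlgebra p) • s ∈ TSubmodule p D.S) :
    ∃ w ∈ F.generators 0, ¬ IsOfFinAddOrder w := by
  by_contra hall
  push Not at hall
  -- a common annihilator of `y_K` and `z_0`
  have hy : IsOfFinAddOrder F.y := hall _ (F.y_mem_generators 0)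
  have hz : IsOfFinAddOrder (F.z 0) := hall _ (F.z_mem_generators le_rfl)
  set n : ℕ := addOrderOf F.y * addOrderOf (F.z 0) with hn_def
  have hn0 : n ≠ 0 := mul_ne_zero hy.addOrderOf_pos.ne' hz.addOrderOf_pos.ne'
  have hkill : ∀ w ∈ F.generators 0, n • w = 0 := by
    intro w hw
    rcases (F.mem_generators_zero_iff w).mp hw with rfl | rfl
    · rw [hn_def, mul_comm, mul_smul, addOrderOf_nsmul_eq_zero, smul_zero]
    · rw [hn_def, mul_smul, addOrderOf_nsmul_eq_zero, smul_zero]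
  -- the generator `κ_∞` of `ℋ_∞` and its base projection
  obtain ⟨g, -, hg⟩ := exists_heegnerModule_eq_span_singleton_of_free D F hfree hH1
  have hgmem : g ∈ heegnerModule D F := by
    rw [hg]; exact Submodule.mem_span_singleton_self g
  have hproj : D.proj 0 ((n : IwasawaAlgebra p) • g) = 0 :=
    proj_zero_natCast_smul_eq_zero_of_mem_heegnerModule D F hkill hgmem
  obtain ⟨n', hn', hmem⟩ := hctl₀ _ hproj
  rw [smul_smul, ← Nat.cast_mul] at hmem
  obtain ⟨a, ha⟩ := exists_pow_smul_mem_of_natCast_smul_mem (TSubmodule p D.S)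
    (mul_ne_zero hn' hn0) hmem
  exact pow_smul_heegnerGenerator_notMem_TSubmodule_of_finrank D F X hS1 hH1 hX1 hc hMC hctl hg
    a ha

/-- **The `K`-rational basic Heegner point `y_K` has infinite order, off Howard's locus**, given in
addition the distribution relation between the Heegner points of conductor `1` and `p` in the weak
form "`z_0 - a • y_K` is torsion" (`hdist`; Perrin-Riou 1987, §3.3 Lemme 1, Prop. 3); `y_K`
descends to `P ∈ E(K)` (`HeegnerFamily.exists_toGeomPoints_eq_y`). Module-theoretic form of
`exists_point_eq_y_not_isOfFinAddOrder`.
[cite: BurungaleCastellaSkinner2025, Thm. 1.2.2 (a)]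
[cite: PerrinRiou1987BSMF, §3.3 Lemme 1, Prop. 3 and §3.4 Prop. 10]
[cite: YanZhu2024MainConjNonCM, Thm. 4.15 (proof, §4.6)] -/
theorem exists_point_eq_y_not_isOfFinAddOrder_of_finrank
    (D : (W.baseChange K).LambdaAdicSelmerData κ γ) (F : HeegnerFamily N W K κ jbar)
    (X : (W.baseChange K).SelmerDualData κ γ)
    [Module.Finite (IwasawaAlgebra p) D.S] [NoZeroSMulDivisors (IwasawaAlgebra p) D.S]
    (hS1 : Module.finrank (IwasawaAlgebra p) D.S = 1)
    (hfree : Module.Free (IwasawaAlgebra p) (heegnerModule D F))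
    (hH1 : Module.finrank (IwasawaAlgebra p) (heegnerModule D F) = 1)
    [Module.Finite (IwasawaAlgebra p) X.X] (hX1 : Module.finrank (IwasawaAlgebra p) X.X = 1)
    {c : ℤ_[p]} (hc : c ≠ 0)
    (hMC : Ideal.span {(PowerSeries.C c : IwasawaAlgebra p)} *
        Module.charIdeal (IwasawaAlgebra p) (Submodule.torsion (IwasawaAlgebra p) X.X) ≤
      heegnerCharIdeal D F ^ 2)
    (hctl : coinvariantsRank p X.X ≤ 1)
    (hctl₀ : ∀ s : D.S, D.proj 0 s = 0 →
      ∃ n : ℕ, n ≠ 0 ∧ (n : IwasawaAlgebra p) • s ∈ TSubmodule p D.S)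
    (hdist : ∃ a : ℤ, IsOfFinAddOrder (F.z 0 - a • F.y)) :
    ∃ P : (W.baseChange K).toAffine.Point,
      toGeomPoints (W.baseChange K) P = F.y ∧ ¬ IsOfFinAddOrder P := by
  -- `y_K` itself has infinite order
  have hyinf : ¬ IsOfFinAddOrder F.y := by
    intro hy
    obtain ⟨w, hw, hwinf⟩ := exists_mem_generators_zero_not_isOfFinAddOrder_of_finrank D F X hS1
      hfree hH1 hX1 hc hMC hctl hctl₀
    obtain ⟨a, ha⟩ := hdist
    apply hwinf
    rcases (F.mem_generators_zero_iff w).mp hw with rfl | rfl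
    · exact hy
    · have h := ha.add (hy.zsmul (i := a))
      rwa [sub_add_cancel] at h
  obtain ⟨P, hP⟩ := F.exists_toGeomPoints_eq_y
  refine ⟨P, hP, fun hfin ↦ ?_⟩
  have h := (toGeomPoints (W.baseChange K)).isOfFinAddOrder hfin
  rw [hP] at h
  exact hyinf h

/-- **`ord_{s=1} L(E/K, s) = 1` from the rational Heegner point main conjecture, off Howard's
locus** — module-theoretic form of `analyticRankEK_eq_one_of_heegner_specialization`, i.e. the
`K`-level descent with EVERY input explicit and NO image hypothesis: `S = 𝔖_p(K_∞)` finitely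
generated, torsion-free, of rank one (`hS1`; Perrin-Riou 1987, §2.2 Lemme 5 for torsion-freeness),
`ℋ_∞` free of rank one (`hfree`, `hH1`; Cornut–Vatsal + Perrin-Riou Prop. 10), `𝒳` of rank one
(`hX1`) and the rational main conjecture `hMC` — for a CM curve over an auxiliary `K` with (disc),
(Heeg), (spl) at a good ordinary `p ≥ 5` these are Burungale–Castella–Skinner, Thm. 1.2.2 (a), whose
(irr_ℚ) is Serre's theorem (`hasIrreducibleModPGaloisRep_of_hasCM_of_five_le`) —, Mazur's control
with corank one (`hctl`), the base-layer control of `S` (`hctl₀`), the distribution relation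
(`hdist`), the CM identification of `y_K = Norm_{K[1]/K} P[1]` with a Heegner point of
`IsHeegnerPoint` (`hbridge`; Gross 1991, §3), and Gross–Zagier–Kolyvagin over `K` (`hGZK`, tree
fact `analyticRankEK_eq_one_iff_heegner_nonTorsion`). The conclusion is the output of the slot
`hBCGS` of Part 3 for this `(E, K, p)`. Nothing is asserted: all inputs are hypotheses.
[cite: BurungaleCastellaSkinner2025, Thm. 1.2.2 (a) and the remark following it]
[cite: YanZhu2024MainConjNonCM, Thm. 4.15 (proof, §4.6) with Thm. 4.12 (2)]
[cite: PerrinRiou1987BSMF, §2.2 (proof of Lemme 5, p. 417), §3.3 and §3.4 Prop. 10]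
[cite: GrossZagier1986, Thm. I.6.3 with V.§2] -/
theorem analyticRankEK_eq_one_of_heegner_specialization_of_finrank [W.IsElliptic]
    [W.IsGloballyMinimal] (hK : IsImaginaryQuadratic K) (hHeeg : SatisfiesHeegnerHypothesis N K)
    (D : (W.baseChange K).LambdaAdicSelmerData κ γ) (F : HeegnerFamily N W K κ jbar)
    (X : (W.baseChange K).SelmerDualData κ γ)
    [Module.Finite (IwasawaAlgebra p) D.S] [NoZeroSMulDivisors (IwasawaAlgebra p) D.S]
    (hS1 : Module.finrank (IwasawaAlgebra p) D.S = 1)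
    (hfree : Module.Free (IwasawaAlgebra p) (heegnerModule D F))
    (hH1 : Module.finrank (IwasawaAlgebra p) (heegnerModule D F) = 1)
    [Module.Finite (IwasawaAlgebra p) X.X] (hX1 : Module.finrank (IwasawaAlgebra p) X.X = 1)
    {c : ℤ_[p]} (hc : c ≠ 0)
    (hMC : Ideal.span {(PowerSeries.C c : IwasawaAlgebra p)} *
        Module.charIdeal (IwasawaAlgebra p) (Submodule.torsion (IwasawaAlgebra p) X.X) ≤
      heegnerCharIdeal D F ^ 2)
    (hctl : coinvariantsRank p X.X ≤ 1)
    (hctl₀ : ∀ s : D.S, D.proj 0 s = 0 →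
      ∃ n : ℕ, n ≠ 0 ∧ (n : IwasawaAlgebra p) • s ∈ TSubmodule p D.S)
    (hdist : ∃ a : ℤ, IsOfFinAddOrder (F.z 0 - a • F.y))
    (hbridge : ∀ P : (W.baseChange K).toAffine.Point,
      toGeomPoints (W.baseChange K) P = F.y → IsHeegnerPoint N W K P)
    (hGZK : analyticRankEK_eq_one_iff_heegner_nonTorsion W N K)
    (hN : W.conductorNorm ℤ = N) :
    analyticRankEK W K = 1 := by
  obtain ⟨P, hP, hinf⟩ := exists_point_eq_y_not_isOfFinAddOrder_of_finrank D F X hS1 hfree hH1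
    hX1 hc hMC hctl hctl₀ hdist
  exact (hGZK hK hN hHeeg (hbridge P hP)).mpr hinf

end OffHowardLocus

end Literature.NumberTheory.EllipticCurves

end
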